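import Mathlib.Analysis.Calculus.InverseFunctionTheorem.FDeriv
import Mathlib.Analysis.Calculus.FDeriv.Mul
import Mathlib.Analysis.Calculus.FDeriv.Add
import Mathlib.Analysis.Calculus.FDeriv.Prod
import Mathlib.Analysis.Analytic.Polynomial
import Mathlib.Analysis.Analytic.Uniqueness
import Mathlib.Analysis.Normed.Module.Convex
import Mathlib.Algebra.MvPolynomial.Funext
import Literature.Computability.AlgebraicComplexity.AsymptoticRankZariskiClosedProofs
import Literature.Barriers.MatrixMultiplication.UniversalMethodBarrierAsymptoticRank

/-!
# Route `RootDecomp1`, leaf `FourThirdsLawAtThree` — Cartan density, PART 1 of 2 (route-free core)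

LANDING SPLIT (decomp-mm-lander-1 g1, 2026-08-30; mechanical, for the 400-line lint) of the lens-6 landing form
`CartanDensityCore.lean` (sha256 `b62a53bb…7ece`, 532 lines, critic-certified rc0 · 0 sorry · std axioms,
decomp-mm STATUS l.230).  This part = its sections «The Cartan subspace», «The family map `Φ`»,
«The derivative of `Φ`», «The integer certificate», «Density of the image» (source lines 80–343), copied
byte-identically; it imports NO `Theses` file (lint `theses-cone`).  PART 2 = `Theorems/RootDecomp1CartanDensity.lean`
(main theorems, sharpenings, named statements; imports this file and `Theses.RootDecomp1`) carries the full
module docstring of the source.  Both parts SUPPORT item `stmt-MatrixMultiplication-24511` (`FourThirdsLawAtThree`)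
WITHOUT closing it; nothing here proves ω = 2.
-/

set_option linter.dupNamespace false

open scoped BigOperators Topology
open Filter Set

namespace Summit.MatrixMultiplication.MatrixMultiplication.Theorems.CartanDensity

open Literature.Computability.AlgebraicComplexity
open Literature.Barriers.MatrixMultiplication (asymptoticRank_le_of_polyDegeneratesTo)

noncomputable section

/-! ## The Cartan subspace `𝔠 ⊂ ℂ³ ⊗ ℂ³ ⊗ ℂ³` -/

/-- **The Cartan subspace** (Nurmiev's semisimple normal form; the Hessian plane of route
`HessianPlane`): `cartan w (x,y,z) = w(y − x)` on the nine progressions `x + y + z = 0`, else `0`. -/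
def cartan (w : Fin 3 → ℂ) : Fin 3 → Fin 3 → Fin 3 → ℂ :=
  fun x y z => if x + y + z = 0 then w (y - x) else 0

/-- Re-assembling a point of `ℂ³` from its coordinates. -/
theorem cartan_eta (w : Fin 3 → ℂ) : cartan ![w 0, w 1, w 2] = cartan w := by
  have h : (![w 0, w 1, w 2] : Fin 3 → ℂ) = w := by
    funext s; fin_cases s <;> rfl
  rw [h]

/-- The three basis tensors `X_s` of `𝔠`, integer model: `X_s(x,y,z) = [x+y+z = 0 ∧ y−x = s]`. -/
def basisℤ (s x y z : Fin 3) : ℤ := if x + y + z = 0 ∧ y - x = s then 1 else 0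

/-- The three basis tensors `X_s` of `𝔠` over `ℂ`. -/
def basis (s x y z : Fin 3) : ℂ := if x + y + z = 0 ∧ y - x = s then 1 else 0

/-- `basis` is the cast of its integer model. -/
theorem basis_eq_cast (s x y z : Fin 3) : basis s x y z = (basisℤ s x y z : ℂ) := by
  unfold basis basisℤ
  split_ifs <;> simp

/-- `cartan w = Σ_s w_s · X_s`, entrywise. -/
theorem cartan_eq_sum (w : Fin 3 → ℂ) (x y z : Fin 3) :
    cartan w x y z = ∑ s, w s * basis s x y z := by
  unfold cartan basis
  by_cases h : x + y + z = 0
  · simp only [h, true_and, if_true]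
    rw [Finset.sum_eq_single (y - x)]
    · simp
    · intro s _ hs
      simp [Ne.symm hs]
    · intro h'
      exact absurd (Finset.mem_univ _) h'
  · simp [h]

/-! ## The family map `Φ` -/

/-- Parameter space `ℂ³⁶`: `M 0 = A`, `M 1 = B`, `M 2 = C` (three `3 × 3` matrices), `M 3 0 = w`
(the plane coordinate; `M 3 1`, `M 3 2` are idle). -/
abbrev Param : Type := Fin 4 → Fin 3 → Fin 3 → ℂ

/-- `Φ(A, B, C, w) = (A ⊗ B ⊗ C) · cartan w ∈ ℂ³ ⊗ ℂ³ ⊗ ℂ³`, written out through the basis `X_s`. -/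
def famMap (M : Param) : Fin 3 → Fin 3 → Fin 3 → ℂ :=
  fun i j k => ∑ a, ∑ b, ∑ c, ∑ s, M 0 i a * M 1 j b * M 2 k c * M 3 0 s * basis s a b c

/-- Every `Φ(M)` is a restriction of the plane point `cartan (M 3 0)`. -/
theorem cartan_restrictsTo_famMap (M : Param) :
    TensorRestrictsTo (cartan (M 3 0)) (famMap M) := by
  refine ⟨M 0, M 1, M 2, fun i j k => ?_⟩
  simp only [famMap, cartan_eq_sum, Finset.mul_sum]
  refine Finset.sum_congr rfl fun a _ => Finset.sum_congr rfl fun b _ =>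
    Finset.sum_congr rfl fun c _ => Finset.sum_congr rfl fun s _ => ?_
  ring

/-- Hence `R̃(Φ M) ≤ R̃(cartan (M 3 0))` (a restriction is a degeneration; `R̃` is monotone). -/
theorem asymptoticRank_famMap_le (M : Param) :
    asymptoticRank (famMap M) ≤ asymptoticRank (cartan (M 3 0)) :=
  asymptoticRank_le_of_polyDegeneratesTo (cartan_restrictsTo_famMap M).polyDegeneratesTo

/-! ## The derivative of `Φ` -/

/-- The Jacobian of `Φ` applied to a direction `V` (polarisation of the `4`-linear map), over any
commutative ring. -/
def jacApply {R : Type} [CommRing R] (X : Fin 3 → Fin 3 → Fin 3 → Fin 3 → R)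
    (M V : Fin 4 → Fin 3 → Fin 3 → R) : Fin 3 → Fin 3 → Fin 3 → R :=
  fun i j k => ∑ a, ∑ b, ∑ c, ∑ s, X s a b c *
    (V 0 i a * M 1 j b * M 2 k c * M 3 0 s + M 0 i a * V 1 j b * M 2 k c * M 3 0 s +
      M 0 i a * M 1 j b * V 2 k c * M 3 0 s + M 0 i a * M 1 j b * M 2 k c * V 3 0 s)

/-- The coordinate `M ↦ M l i a` as a continuous linear form on `Param`. -/
def coord (l : Fin 4) (i a : Fin 3) : Param →L[ℂ] ℂ :=
  (ContinuousLinearMap.proj a).comp ((ContinuousLinearMap.proj i).comp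
    (ContinuousLinearMap.proj (R := ℂ) (φ := fun _ : Fin 4 => Fin 3 → Fin 3 → ℂ) l))

/-- A coordinate is its own strict derivative. -/
theorem hasStrictFDerivAt_coord (l : Fin 4) (i a : Fin 3) (M₀ : Param) :
    HasStrictFDerivAt (fun M : Param => M l i a) (coord l i a) M₀ :=
  (coord l i a).hasStrictFDerivAt

/-- The derivative of one quartic term of `Φ`. -/
theorem hasStrictFDerivAt_term (M₀ : Param) (i j k a b c s : Fin 3) :
    HasStrictFDerivAt (fun M : Param => M 0 i a * M 1 j b * M 2 k c * M 3 0 s * basis s a b c)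
      (basis s a b c • ((M₀ 0 i a * M₀ 1 j b * M₀ 2 k c) • coord 3 0 s +
        M₀ 3 0 s • ((M₀ 0 i a * M₀ 1 j b) • coord 2 k c +
          M₀ 2 k c • (M₀ 0 i a • coord 1 j b + M₀ 1 j b • coord 0 i a)))) M₀ :=
  ((((hasStrictFDerivAt_coord 0 i a M₀).mul (hasStrictFDerivAt_coord 1 j b M₀)).mul
    (hasStrictFDerivAt_coord 2 k c M₀)).mul (hasStrictFDerivAt_coord 3 0 s M₀)).mul_const
    (basis s a b c)

/-- The derivative of the entry `Φ(·)_{ijk}` at `M₀`, as a continuous linear form. -/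
def entryDeriv (M₀ : Param) (i j k : Fin 3) : Param →L[ℂ] ℂ :=
  ∑ a, ∑ b, ∑ c, ∑ s, basis s a b c • ((M₀ 0 i a * M₀ 1 j b * M₀ 2 k c) • coord 3 0 s +
    M₀ 3 0 s • ((M₀ 0 i a * M₀ 1 j b) • coord 2 k c +
      M₀ 2 k c • (M₀ 0 i a • coord 1 j b + M₀ 1 j b • coord 0 i a)))

/-- The entry `Φ(·)_{ijk}` is strictly differentiable with derivative `entryDeriv`. -/
theorem hasStrictFDerivAt_entry (M₀ : Param) (i j k : Fin 3) :
    HasStrictFDerivAt (fun M : Param => famMap M i j k) (entryDeriv M₀ i j k) M₀ := by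
  unfold famMap entryDeriv
  exact HasStrictFDerivAt.fun_sum fun a _ => HasStrictFDerivAt.fun_sum fun b _ =>
    HasStrictFDerivAt.fun_sum fun c _ => HasStrictFDerivAt.fun_sum fun s _ =>
      hasStrictFDerivAt_term M₀ i j k a b c s

/-- `entryDeriv` evaluates to the `(i,j,k)` entry of `jacApply basis M₀`. -/
theorem entryDeriv_apply (M₀ V : Param) (i j k : Fin 3) :
    entryDeriv M₀ i j k V = jacApply basis M₀ V i j k := by
  simp only [entryDeriv, jacApply, FunLike.coe_sum, Finset.sum_apply, FunLike.coe_smul,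
    Pi.smul_apply, _root_.add_apply, _root_.smul_apply, coord, ContinuousLinearMap.coe_comp,
    Function.comp_apply, ContinuousLinearMap.proj_apply, smul_eq_mul]
  refine Finset.sum_congr rfl fun a _ => Finset.sum_congr rfl fun b _ =>
    Finset.sum_congr rfl fun c _ => Finset.sum_congr rfl fun s _ => ?_
  ring

/-- The derivative of `Φ` at `M₀` as a continuous linear map `ℂ³⁶ → ℂ²⁷`. -/
def totalDeriv (M₀ : Param) : Param →L[ℂ] (Fin 3 → Fin 3 → Fin 3 → ℂ) :=
  ContinuousLinearMap.pi fun i => ContinuousLinearMap.pi fun j =>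
    ContinuousLinearMap.pi fun k => entryDeriv M₀ i j k

/-- `totalDeriv M₀ V = jacApply basis M₀ V`. -/
theorem totalDeriv_apply (M₀ V : Param) : totalDeriv M₀ V = jacApply basis M₀ V := by
  funext i j k
  simp [totalDeriv, entryDeriv_apply]

/-- **`Φ` is strictly differentiable with derivative `V ↦ jacApply basis M₀ V`.** -/
theorem hasStrictFDerivAt_famMap (M₀ : Param) :
    HasStrictFDerivAt famMap (totalDeriv M₀) M₀ := by
  have h3 : ∀ i j : Fin 3, HasStrictFDerivAt (fun (M : Param) (k : Fin 3) => famMap M i j k)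
      (ContinuousLinearMap.pi fun k => entryDeriv M₀ i j k) M₀ :=
    fun i j => hasStrictFDerivAt_pi.2 fun k => hasStrictFDerivAt_entry M₀ i j k
  have h2 : ∀ i : Fin 3, HasStrictFDerivAt (fun (M : Param) (j : Fin 3) => fun k => famMap M i j k)
      (ContinuousLinearMap.pi fun j => ContinuousLinearMap.pi fun k => entryDeriv M₀ i j k) M₀ :=
    fun i => hasStrictFDerivAt_pi.2 fun j => h3 i j
  exact hasStrictFDerivAt_pi.2 fun i => h2 i

/-! ## The integer certificate: the derivative at `M₀ = (I, I, I, (1,−1,1))` is onto -/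

/-- The base point `M₀ = (I, I, I, w₀)`, `w₀ = (1,−1,1)` a regular point of `𝔠` (idle rows zero). -/
def basePointℤ : Fin 4 → Fin 3 → Fin 3 → ℤ :=
  ![![![1, 0, 0], ![0, 1, 0], ![0, 0, 1]], ![![1, 0, 0], ![0, 1, 0], ![0, 0, 1]],
    ![![1, 0, 0], ![0, 1, 0], ![0, 0, 1]], ![![1, -1, 1], ![0, 0, 0], ![0, 0, 0]]]

/-- Table of the `27` certificate directions `W_{ijk} ∈ ℤ³⁶` (indices `i j k l i' a`), found by
exact integer linear algebra (Hermite form of the `27 × 36` Jacobian; lattice exponent `42`). -/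
def certDir : Fin 3 → Fin 3 → Fin 3 → Fin 4 → Fin 3 → Fin 3 → ℤ :=
  ![![![![![![14, 0, 0], ![0, 0, 0], ![0, 0, 0]], ![![0, 0, 0], ![0, -14, 0], ![0, 0, -14]], ![![14, 0, 0], ![0, 0, 0], ![0, 0, 0]], ![![14, 0, 0], ![0, 0, 0], ![0, 0, 0]]], ![![![0, 0, -12], ![18, 0, 0], ![0, -6, 0]], ![![0, 0, 15], ![9, 0, 0], ![0, -3, 0]], ![![0, 0, -3], ![15, 0, 0], ![0, 9, 0]], ![![0, 0, 0], ![0, 0, 0], ![0, 0, 0]]], ![![![0, 15, 0], ![0, 0, -3], ![9, 0, 0]], ![![0, -12, 0], ![0, 0, -6], ![18, 0, 0]], ![![0, -3, 0], ![0, 0, 9], ![15, 0, 0]], ![![0, 0, 0], ![0, 0, 0], ![0, 0, 0]]]], ![![![![0, 0, 15], ![9, 0, 0], ![0, -3, 0]], ![![0, 0, -3], ![15, 0, 0], ![0, 9, 0]], ![![0, 0, -12], ![18, 0, 0], ![0, -6, 0]], ![![0, 0, 0], ![0, 0, 0], ![0, 0, 0]]], ![![![0, 15, 0], ![0, 0,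 -3], ![9, 0, 0]], ![![0, 9, 0], ![0, 0, 15], ![-3, 0, 0]], ![![0, 18, 0], ![0, 0, -12], ![-6, 0, 0]], ![![0, 0, 0], ![0, 0, 0], ![0, 0, 0]]], ![![![-14, 0, 0], ![0, 0, 0], ![0, 0, 0]], ![![0, 0, 0], ![0, -14, 0], ![0, 0, 0]], ![![14, 0, 0], ![0, 14, 0], ![0, 0, 0]], ![![0, 14, 0], ![0, 0, 0], ![0, 0, 0]]]], ![![![![0, -12, 0], ![0, 0, -6], ![18, 0, 0]], ![![0, -3, 0], ![0, 0, 9], ![15, 0, 0]], ![![0, 15, 0], ![0, 0, -3], ![9, 0, 0]], ![![0, 0, 0], ![0, 0, 0], ![0, 0, 0]]], ![![![14, 0, 0], ![0, 0, 0], ![0, 0, 0]], ![![0, 0, 0], ![0, 0, 0], ![0, 0, 14]], ![![0, 0, 0], ![0, 14, 0], ![0, 0, 0]], ![![-14, 14, 0], ![0, 0, 0], ![0, 0, 0]]], ![![![0, 0, 15], ![9, 0, 0], ![0, -3, 0]], ![![0, 0, 18], ![-6, 0, 0], ![0, -12, 0]], ![![0, 0, 9], ![-3, 0, 0], ![0,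 15, 0]], ![![0, 0, 0], ![0, 0, 0], ![0, 0, 0]]]]], ![![![![![0, 0, -3], ![15, 0, 0], ![0, 9, 0]], ![![0, 0, -12], ![18, 0, 0], ![0, -6, 0]], ![![0, 0, 15], ![9, 0, 0], ![0, -3, 0]], ![![0, 0, 0], ![0, 0, 0], ![0, 0, 0]]], ![![![0, 18, 0], ![0, 0, -12], ![-6, 0, 0]], ![![0, 15, 0], ![0, 0, -3], ![9, 0, 0]], ![![0, 9, 0], ![0, 0, 15], ![-3, 0, 0]], ![![0, 0, 0], ![0, 0, 0], ![0, 0, 0]]], ![![![0, 0, 0], ![0, 14, 0], ![0, 0, 0]], ![![14, 0, 0], ![0, 0, 0], ![0, 0, 0]], ![![-3, 0, 0], ![0, -3, 0], ![0, 0, 11]], ![![-11, 11, 3], ![0, 0, 0], ![0, 0, 0]]]], ![![![![0, 9, 0], ![0, 0, 15], ![-3, 0, 0]], ![![0, 18, 0], ![0, 0, -12], ![-6, 0, 0]], ![![0, 15, 0], ![0, 0, -3], ![9, 0, 0]], ![![0, 0, 0], ![0, 0, 0], ![0, 0, 0]]], ![![![0, 0, 0], ![0, 14, 0], ![0, 0,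 0]], ![![-14, 0, 0], ![0, 0, 0], ![0, 0, -14]], ![![0, 0, 0], ![0, 14, 0], ![0, 0, 0]], ![![14, 0, 0], ![0, 0, 0], ![0, 0, 0]]], ![![![0, 0, -6], ![-12, 0, 0], ![0, 18, 0]], ![![0, 0, -3], ![15, 0, 0], ![0, 9, 0]], ![![0, 0, 9], ![-3, 0, 0], ![0, 15, 0]], ![![0, 0, 0], ![0, 0, 0], ![0, 0, 0]]]], ![![![![0, 0, 0], ![0, -14, 0], ![0, 0, 0]], ![![14, 0, 0], ![0, 14, 0], ![0, 0, 0]], ![![-14, 0, 0], ![0, 0, 0], ![0, 0, 0]], ![![0, 14, 0], ![0, 0, 0], ![0, 0, 0]]], ![![![0, 0, -3], ![15, 0, 0], ![0, 9, 0]], ![![0, 0, 9], ![-3, 0, 0], ![0, 15, 0]], ![![0, 0, -6], ![-12, 0, 0], ![0, 18, 0]], ![![0, 0, 0], ![0, 0, 0], ![0, 0, 0]]], ![![![0, 9, 0], ![0, 0, 15], ![-3, 0, 0]], ![![0, -3, 0], ![0, 0, 9], ![15, 0, 0]], ![![0, -6, 0], ![0, 0, 18], ![-12, 0, 0]], ![![0,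 0, 0], ![0, 0, 0], ![0, 0, 0]]]]], ![![![![![0, -3, 0], ![0, 0, 9], ![15, 0, 0]], ![![0, 15, 0], ![0, 0, -3], ![9, 0, 0]], ![![0, -12, 0], ![0, 0, -6], ![18, 0, 0]], ![![0, 0, 0], ![0, 0, 0], ![0, 0, 0]]], ![![![14, 0, 0], ![0, 14, 0], ![0, 0, 0]], ![![-14, 0, 0], ![0, 0, 0], ![0, 0, 0]], ![![0, 0, 0], ![0, -14, 0], ![0, 0, 0]], ![![0, 14, 0], ![0, 0, 0], ![0, 0, 0]]], ![![![0, 0, 9], ![-3, 0, 0], ![0, 15, 0]], ![![0, 0, 15], ![9, 0, 0], ![0, -3, 0]], ![![0, 0, 18], ![-6, 0, 0], ![0, -12, 0]], ![![0, 0, 0], ![0, 0, 0], ![0, 0, 0]]]], ![![![![-1, 0, 0], ![0, -1, 0], ![0, 0, 13]], ![![0, 0, 0], ![0, 14, 0], ![0, 0, 0]], ![![15, 0, 0], ![0, 1, 0], ![0, 0, 1]], ![![-14, 14, 0], ![0, 0, 0], ![0, 0, 0]]], ![![![0, 0, 9], ![-3, 0, 0], ![0, 15, 0]], ![![0, 0,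 -6], ![-12, 0, 0], ![0, 18, 0]], ![![0, 0, -3], ![15, 0, 0], ![0, 9, 0]], ![![0, 0, 0], ![0, 0, 0], ![0, 0, 0]]], ![![![0, -6, 0], ![0, 0, 18], ![-12, 0, 0]], ![![0, 9, 0], ![0, 0, 15], ![-3, 0, 0]], ![![0, -3, 0], ![0, 0, 9], ![15, 0, 0]], ![![0, 0, 0], ![0, 0, 0], ![0, 0, 0]]]], ![![![![0, 0, 18], ![-6, 0, 0], ![0, -12, 0]], ![![0, 0, 9], ![-3, 0, 0], ![0, 15, 0]], ![![0, 0, 15], ![9, 0, 0], ![0, -3, 0]], ![![0, 0, 0], ![0, 0, 0], ![0, 0, 0]]], ![![![0, -3, 0], ![0, 0, 9], ![15, 0, 0]], ![![0, -6, 0], ![0, 0, 18], ![-12, 0, 0]], ![![0, 9, 0], ![0, 0, 15], ![-3, 0, 0]], ![![0, 0, 0], ![0, 0, 0], ![0, 0, 0]]], ![![![-11, 0, 0], ![0, -11, 0], ![0, 0, 3]], ![![0, 0, 0], ![0, 0, 0], ![0, 0, 14]], ![![-3, 0, 0], ![0, -3, 0], ![0, 0, 11]], ![![14, 0, 0], ![0,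 0, 0], ![0, 0, 0]]]]]]

/-- **Kernel certificate**: `jacApply X M₀ W_{ijk} = 42 · e_i ⊗ e_j ⊗ e_k` for all `27` triples. -/
theorem cert : ∀ i j k : Fin 3, jacApply basisℤ basePointℤ (certDir i j k) =
    fun i' j' k' => if i' = i ∧ j' = j ∧ k' = k then 42 else 0 := by
  decide +kernel

/-- Integer parameters as complex ones. -/
def castParam (M : Fin 4 → Fin 3 → Fin 3 → ℤ) : Param := fun l i a => (M l i a : ℂ)

/-- `jacApply` commutes with the cast `ℤ → ℂ`. -/
theorem jacApply_cast (X : Fin 3 → Fin 3 → Fin 3 → Fin 3 → ℤ) (M V : Fin 4 → Fin 3 → Fin 3 → ℤ) :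
    jacApply (fun s a b c => (X s a b c : ℂ)) (castParam M) (castParam V) =
      fun i j k => ((jacApply X M V i j k : ℤ) : ℂ) := by
  funext i j k
  simp [jacApply, castParam]

/-- The base point in `ℂ³⁶`. -/
def basePoint : Param := castParam basePointℤ

/-- The plane coordinate of the base point is `w₀ = (1,−1,1)`. -/
theorem basePoint_plane : basePoint 3 0 = ![(1 : ℂ), -1, 1] := by
  funext a
  fin_cases a <;> simp [basePoint, castParam, basePointℤ]

/-- `basis` is the cast of `basisℤ` as a function. -/
theorem basis_eq_cast_fun : basis = fun s a b c => (basisℤ s a b c : ℂ) := by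
  funext s a b c
  exact basis_eq_cast s a b c

/-- The derivative of `Φ` at `M₀` hits `42 · e_{ijk}`. -/
theorem totalDeriv_certDir (i j k : Fin 3) :
    totalDeriv basePoint (castParam (certDir i j k)) =
      fun i' j' k' => if i' = i ∧ j' = j ∧ k' = k then (42 : ℂ) else 0 := by
  rw [totalDeriv_apply, basis_eq_cast_fun, basePoint, jacApply_cast, cert]
  funext i' j' k'
  by_cases h : (i' = i ∧ j' = j ∧ k' = k) <;> simp [h]

/-- The normalised certificate direction `W_{ijk} / 42`. -/
def certVec (i j k : Fin 3) : Param := (42 : ℂ)⁻¹ • castParam (certDir i j k)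

/-- The derivative of `Φ` at `M₀` hits every elementary tensor. -/
theorem totalDeriv_certVec (i j k : Fin 3) :
    totalDeriv basePoint (certVec i j k) =
      fun i' j' k' => if i' = i ∧ j' = j ∧ k' = k then 1 else 0 := by
  rw [certVec, map_smul, totalDeriv_certDir]
  funext i' j' k'
  simp only [Pi.smul_apply, smul_eq_mul, mul_ite, mul_zero]
  split_ifs <;> norm_num

/-- **The derivative of `Φ` at `M₀` is surjective.** -/
theorem totalDeriv_surjective : Function.Surjective (totalDeriv basePoint) := by
  intro T
  refine ⟨∑ i, ∑ j, ∑ k, T i j k • certVec i j k, ?_⟩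
  simp only [map_sum, map_smul, totalDeriv_certVec]
  funext i' j' k'
  simp only [Finset.sum_apply, Pi.smul_apply, smul_eq_mul, mul_ite, mul_one, mul_zero]
  rw [Finset.sum_eq_single i', Finset.sum_eq_single j', Finset.sum_eq_single k']
  · simp
  all_goals first
    | (intro b _ hb; simp [Ne.symm hb])
    | (intro h; exact absurd (Finset.mem_univ _) h)

/-- The derivative of `Φ` at `M₀` has full range. -/
theorem range_totalDeriv : (totalDeriv basePoint).range = ⊤ :=
  LinearMap.range_eq_top.2 totalDeriv_surjective

/-! ## Density of the image -/

/-- `Φ` maps the neighbourhood filter of `M₀` onto that of `Φ(M₀)` (inverse function theorem). -/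
theorem map_nhds_famMap : map famMap (𝓝 basePoint) = 𝓝 (famMap basePoint) :=
  (hasStrictFDerivAt_famMap basePoint).map_nhds_eq_of_surj range_totalDeriv

/-- The image of `Φ` is a neighbourhood of `Φ(M₀)`. -/
theorem range_famMap_mem_nhds : Set.range famMap ∈ 𝓝 (famMap basePoint) := by
  rw [← map_nhds_famMap]
  exact Filter.range_mem_map

/-- **Local identity principle.** A polynomial in the `27` entries vanishing on `Φ(M)` for all `M`
NEAR `M₀` vanishes identically on `ℂ³ ⊗ ℂ³ ⊗ ℂ³`. -/
theorem eval_eq_zero_of_eventually_famMap (p : MvPolynomial (Fin 3 × Fin 3 × Fin 3) ℂ)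
    (hp : ∀ᶠ M in 𝓝 basePoint, MvPolynomial.eval (tensorEntries (famMap M)) p = 0)
    (T : Fin 3 → Fin 3 → Fin 3 → ℂ) : MvPolynomial.eval (tensorEntries T) p = 0 := by
  let L : (Fin 3 → Fin 3 → Fin 3 → ℂ) →ₗ[ℂ] (Fin 3 × Fin 3 × Fin 3 → ℂ) :=
    { toFun := tensorEntries, map_add' := fun _ _ => rfl, map_smul' := fun _ _ => rfl }
  have han : AnalyticOnNhd ℂ (fun S : Fin 3 → Fin 3 → Fin 3 → ℂ => MvPolynomial.eval (L S) p)
      Set.univ := AnalyticOnNhd.eval_linearMap L p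
  have hev : (fun S : Fin 3 → Fin 3 → Fin 3 → ℂ => MvPolynomial.eval (L S) p)
      =ᶠ[𝓝 (famMap basePoint)] 0 := by
    have h' : ∀ᶠ S in map famMap (𝓝 basePoint),
        MvPolynomial.eval (tensorEntries S) p = 0 := by
      rw [Filter.eventually_map]
      exact hp
    rw [map_nhds_famMap] at h'
    exact h'
  have h := han.eqOn_zero_of_preconnected_of_eventuallyEq_zero isPreconnected_univ
    (Set.mem_univ _) hev
  exact h (Set.mem_univ T)

/-- **Identity principle.** A polynomial in the `27` entries vanishing on all `Φ(M)` vanishes at every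
tensor. -/
theorem eval_eq_zero_of_forall_famMap (p : MvPolynomial (Fin 3 × Fin 3 × Fin 3) ℂ)
    (hp : ∀ M : Param, MvPolynomial.eval (tensorEntries (famMap M)) p = 0)
    (T : Fin 3 → Fin 3 → Fin 3 → ℂ) : MvPolynomial.eval (tensorEntries T) p = 0 :=
  eval_eq_zero_of_eventually_famMap p (Filter.Eventually.of_forall hp) T

/-- **Zariski density of `GL₃³ · 𝔠`** (polynomial form): a polynomial on `ℂ³ ⊗ ℂ³ ⊗ ℂ³` vanishing on every
`(A ⊗ B ⊗ C)·cartan w` is the zero polynomial. -/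
theorem eq_zero_of_forall_famMap (p : MvPolynomial (Fin 3 × Fin 3 × Fin 3) ℂ)
    (hp : ∀ M : Param, MvPolynomial.eval (tensorEntries (famMap M)) p = 0) : p = 0 := by
  refine MvPolynomial.funext fun x => ?_
  have h := eval_eq_zero_of_forall_famMap p hp (fun i j k => x (i, j, k))
  have hx : tensorEntries (fun i j k => x (i, j, k)) = x := by
    funext y; simp [tensorEntries]
  rw [hx] at h
  simpa using h


end

end Summit.MatrixMultiplication.MatrixMultiplication.Theorems.CartanDensity
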